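import Literature.Computability.QuantumComplexity.CWrapAssembly
import Literature.Computability.Cryptography.ShorAssemblyLeavesProofs
import Literature.Computability.Complexity.AdaptivePrograms
import Literature.Computability.Complexity.CodeFPStrings
import Literature.Computability.Complexity.CodeFPArith
import Literature.Computability.Complexity.CodeFPModArith
import Literature.Computability.Complexity.KnapsackPartition
import Literature.Computability.Complexity.AlgebraicQueryRectangles
import HarnessLib

/-!
# `FBQP` functions as oracles: the bit-graph language of an `FBQP` function, and parallel oracle queries

Topic `Computability/QuantumComplexity`. A classical polynomial-time machine that wants to USE the value `f x` of a
function `f ∈ FBQP` (Aaronson 2010, §1: some uniform quantum family outputs a string with prefix `f x` with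
probability `≥ 2/3`) — e.g. the prime factorisation computed by Shor's algorithm — does so, in the oracle model
`BPP^{BQP}` / `P^{BQP}` (Bennett–Bernstein–Brassard–Vazirani 1997, §4; Arora–Barak 2009, §3.4, §10.4), through the
BIT-GRAPH LANGUAGE `L_f = {⟨x, i⟩ | bit i of pad(f x)}` where `pad s = s.flatMap (b ↦ [1, b])` is the
self-delimiting doubling of `f x`. This file proves, definition-free over the tree's models:

* `AdQuery.AdPres.batch` — PARALLEL QUERIES are an adaptive `FP` program: for `f ∈ FP` and a polynomial `p`,
  `w ↦ ⟨w, [f ⟨w, 0⟩ ∈ A] ⋯ [f ⟨w, p(|w|) − 1⟩ ∈ A]⟩` is presented over any oracle language `A`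
  (`AdaptivePrograms.lean`), hence in `FP^A`;
* `bitGraph_mem_BQP` — if `f ∈ FBQP` admits a polynomial-time CANONICALISER `pick` (`pick ⟨x, y⟩ = f x` whenever
  `f x` is a prefix of `y`; e.g. re-encoding of a self-delimiting code), then `L_f ∈ BQP` (classical wrap
  `isQSolvable_classicalWrap_holds` + `mem_BQP_of_isQSolvable_bit`);
* `adPres_graph` — conversely `x ↦ ⟨x, f x⟩` is an adaptive `FP` program over `L_f` (`2·p(|x|)` parallel bit queries
  and un-padding), for any polynomial bound `|f x| ≤ p(|x|)`;
* the instance `f x = encode (primeFactorsList (decodeNat x))` (Shor: the tree's PROVED `isQSolvable_factoring_holds`;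
  the list code is self-delimiting, `listBool_decode_encode_append`): `factorGraph_mem_BQP`, `adPres_primeFactors`.

## References

* C. H. Bennett, E. Bernstein, G. Brassard, U. Vazirani, *Strengths and weaknesses of quantum computing*, SIAM J.
  Comput. 26 (1997) 1510–1523, §4 (Thm. 4.14, Cor. 4.15: `BQP^BQP = BQP`).
* S. Aaronson, *BQP and the polynomial hierarchy*, STOC 2010, §1 (`FBQP`).
* S. Arora, B. Barak, *Computational Complexity: A Modern Approach*, CUP 2009, §3.4, §10.4.
* P. W. Shor, SIAM J. Comput. 26 (1997) 1484–1509, §5.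
-/

namespace Literature.Computability.Complexity.AdQuery.AdPres

open _root_.Computability Polynomial Brick Plumb CodeFP

/-- **Parallel (non-adaptive) queries are presented**: for `f ∈ FP` and a polynomial `p`, the function
`w ↦ ⟨w, b₀ ⋯ b_{p(|w|)−1}⟩`, `bᵢ = [f ⟨w, bin i⟩ ∈ A]`, is an adaptive `FP` program over `A` — the query generator asks
`f ⟨w, bin (number of answers so far)⟩`. [cite: AroraBarak2009, §3.4] -/
theorem batch {A : Language Bool} {f : List Bool → List Bool} (hf : f ∈ FP) (p : Polynomial ℕ) :
    AdPres A (fun w => boolPair w ((List.range (p.eval w.length)).map fun i =>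
      A.boolIndicator (f (boolPair w (encodeNat i))))) := by
  obtain ⟨N, hN, hNs⟩ := strNatLength
  have hN' : ∀ bs : List Bool, N bs = encodeNat bs.length := fun bs => hNs bs
  have hid : (fun w : List Bool => w) ∈ FP := PolyTimeComputable.id _
  refine ⟨f ∘ fanoutFn fstF (N ∘ sndF), fun w => w, p, comp_mem_FP hf (fanoutFn_mem_FP fstF_mem_FP
    (comp_mem_FP hN sndF_mem_FP)), hid, fun w => ?_⟩
  have h : ∀ k, adBits (f ∘ fanoutFn fstF (N ∘ sndF)) A w k =
      (List.range k).map fun i => A.boolIndicator (f (boolPair w (encodeNat i))) := by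
    intro k
    induction k with
    | zero => rw [adBits_zero, List.range_zero, List.map_nil]
    | succ k ih =>
      rw [adBits_succ, ih, List.range_succ, List.map_append, List.map_singleton, Function.comp_apply,
        fanoutFn_apply, fstF_boolPair, Function.comp_apply, sndF_boolPair, hN', List.length_map, List.length_range]
  exact congrArg (boolPair w) (h _).symm

end Literature.Computability.Complexity.AdQuery.AdPres

namespace Literature.Computability.QuantumComplexity

open _root_.Computability Literature.Computability.Complexity Literature.Computability.Cryptography
open Literature.Computability.Complexity.CodeFP Literature.Computability.Complexity.Brick
open Literature.Computability.Complexity.Knapsack (decNatList canonLFn canonLFn_eq canonLFn_mem_FP)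

/-! ### The padding -/

/-- Even positions of the padded code flag the length. [folklore] -/
theorem getD_pad_even (s : List Bool) (k : ℕ) :
    (s.flatMap fun b => [true, b]).getD (2 * k) false = decide (k < s.length) := by
  induction s generalizing k with
  | nil => simp
  | cons b s ih =>
    cases k with
    | zero => simp
    | succ k =>
      rw [show 2 * (k + 1) = 2 * k + 1 + 1 by ring, List.flatMap_cons, List.cons_append, List.cons_append,
        List.nil_append, List.getD_cons_succ, List.getD_cons_succ, ih, List.length_cons]
      simp

/-- Odd positions of the padded code carry the bits. [folklore] -/
theorem getD_pad_odd (s : List Bool) (k : ℕ) :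
    (s.flatMap fun b => [true, b]).getD (2 * k + 1) false = s.getD k false := by
  induction s generalizing k with
  | nil => simp
  | cons b s ih =>
    cases k with
    | zero => simp
    | succ k =>
      rw [show 2 * (k + 1) + 1 = 2 * k + 1 + 1 + 1 by ring, List.flatMap_cons, List.cons_append, List.cons_append,
        List.nil_append, List.getD_cons_succ, List.getD_cons_succ, ih, List.getD_cons_succ]

/-- All positions of the padded code, by parity. [folklore] -/
theorem getD_pad (s : List Bool) (i : ℕ) : (s.flatMap fun b => [true, b]).getD i false =
    if i % 2 = 0 then decide (i / 2 < s.length) else s.getD (i / 2) false := by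
  rcases Nat.even_or_odd i with ⟨k, rfl⟩ | ⟨k, rfl⟩
  · rw [← two_mul, getD_pad_even, if_pos (by omega)]; congr 2; omega
  · rw [getD_pad_odd, if_neg (by omega)]; congr 1; omega

/-- **Un-padding**: reading back `2P ≥ 2|s|` positions of the padded code recovers `s`. [folklore] -/
theorem unpad_eq (s : List Bool) {P : ℕ} (hP : s.length ≤ P) :
    ((List.range P).filterMap fun k =>
      if ((List.range (2 * P)).map fun i => (s.flatMap fun b => [true, b]).getD i false).getD (2 * k) false then
        some (((List.range (2 * P)).map fun i => (s.flatMap fun b => [true, b]).getD i false).getD (2 * k + 1) false)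
      else none) = s := by
  have hget : ∀ j < 2 * P, ((List.range (2 * P)).map fun i => (s.flatMap fun b => [true, b]).getD i false).getD j false =
      (s.flatMap fun b => [true, b]).getD j false := fun j hj => by
    rw [List.getD_eq_getElem _ _ (by simpa using hj)]; simp
  have hkey : ∀ k < P, (if ((List.range (2 * P)).map fun i => (s.flatMap fun b => [true, b]).getD i false).getD (2 * k) false
      then some (((List.range (2 * P)).map fun i => (s.flatMap fun b => [true, b]).getD i false).getD (2 * k + 1) false)
      else none) = if k < s.length then some (s.getD k false) else none := fun k hk => by
    rw [hget _ (by omega), hget _ (by omega), getD_pad_even, getD_pad_odd]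
    by_cases h : k < s.length <;> simp [h]
  rw [List.filterMap_congr fun k hk => hkey k (List.mem_range.1 hk)]
  obtain ⟨d, hd⟩ := Nat.exists_eq_add_of_le hP
  rw [hd, List.range_add, List.filterMap_append]
  have h1 : ((List.range s.length).filterMap fun k => if k < s.length then some (s.getD k false) else none) = s := by
    rw [List.filterMap_congr (g := fun k => some (s.getD k false)) fun k hk => by rw [if_pos (List.mem_range.1 hk)],
      List.filterMap_eq_map']
    refine List.ext_getElem (by simp) fun i h₁ h₂ => ?_
    rw [List.getElem_map, List.getElem_range, List.getD_eq_getElem _ _ h₂]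
  have h2 : (((List.range d).map fun k => s.length + k).filterMap fun k =>
      if k < s.length then some (s.getD k false) else none) = [] :=
    List.filterMap_eq_nil_iff.2 fun k hk => by
      obtain ⟨j, -, rfl⟩ := List.mem_map.1 hk
      rw [if_neg (by omega)]
  rw [h1, h2, List.append_nil]

/-! ### The bit-graph language of an `FBQP` function is in `BQP` -/

/-- **The post-processor of the decider** (an `FP` program): on `⟨u, y⟩`, the bit "`u` is a canonical pair
`⟨x, bin i⟩` and position `i` of `pad (pick ⟨x, y⟩)` is set" (even positions: `i/2 < |pick|`; odd: bit `i/2`).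
[cite: AroraBarak2009, §1.3] -/
theorem bitGraph_post_exists {pick : List Bool → List Bool} (hpick : pick ∈ FP) :
    ∃ g : List Bool → List Bool, g ∈ FP ∧ ∀ u y : List Bool, g (boolPair u y) =
      [decide (u = boolPair (fstF u) (encodeNat (decodeNat (sndF u)))) &&
        if decide (decodeNat (sndF u) % 2 = 0) then decide (decodeNat (sndF u) / 2 < (pick (boolPair (fstF u) y)).length)
        else (pick (boolPair (fstF u) y)).getD (decodeNat (sndF u) / 2) false] := by
  have cU1 : CodeFP (pairE strE strE) strE (fun p => fstF p.1) :=
    ⟨fstF ∘ fstF, comp_mem_FP fstF_mem_FP fstF_mem_FP, fun p => by simp⟩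
  have cDec : CodeFP strE natE decodeNat := ⟨canonF, canonF_mem_FP, fun w => canonF_eq_encodeNat_decodeNat w⟩
  have cI : CodeFP (pairE strE strE) natE (fun p => decodeNat (sndF p.1)) :=
    cDec.comp ⟨sndF ∘ fstF, comp_mem_FP sndF_mem_FP fstF_mem_FP, fun p => by simp⟩
  have cR : CodeFP (pairE strE strE) strE (fun p => boolPair (fstF p.1) (encodeNat (decodeNat (sndF p.1)))) :=
    (cU1.pair cI).recodeOut (eγ := strE) fun p => rfl
  have cCanon : CodeFP (pairE strE strE) bitE (fun p => decide (p.1 = boolPair (fstF p.1) (encodeNat (decodeNat (sndF p.1))))) :=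
    (CodeFP.eq (eα := strE) fun _ _ h => h).comp ((CodeFP.fst strE strE).pair cR)
  have cS : CodeFP (pairE strE strE) strE (fun p => pick (boolPair (fstF p.1) p.2)) :=
    ⟨pick ∘ fanoutFn (fstF ∘ fstF) sndF, comp_mem_FP hpick (fanoutFn_mem_FP (comp_mem_FP fstF_mem_FP fstF_mem_FP)
      sndF_mem_FP), fun p => by simp⟩
  have cHalf : CodeFP (pairE strE strE) natE (fun p => decodeNat (sndF p.1) / 2) := natDiv.comp (cI.pair (const _ 2))
  have cEven : CodeFP (pairE strE strE) bitE (fun p => decide (decodeNat (sndF p.1) % 2 = 0)) :=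
    natEq.comp ((natMod.comp (cI.pair (const _ 2))).pair (const _ 0))
  have cLt : CodeFP (pairE strE strE) bitE (fun p => decide (decodeNat (sndF p.1) / 2 < (pick (boolPair (fstF p.1) p.2)).length)) :=
    natLt.comp (cHalf.pair (strNatLength.comp cS))
  have cBit : CodeFP (pairE strE strE) bitE (fun p => (pick (boolPair (fstF p.1) p.2)).getD (decodeNat (sndF p.1) / 2) false) :=
    strGetDNat.comp (cS.pair cHalf)
  obtain ⟨g, hg, hgs⟩ := cCanon.and (cEven.ite cLt cBit)
  exact ⟨g, hg, fun u y => hgs (u, y)⟩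

/-- **The bit-graph language of an `FBQP` function with a polynomial-time canonicaliser is in `BQP`**: if some
uniform quantum family outputs a string with prefix `f x` with probability `≥ 2/3` and `pick ∈ FP` recovers `f x`
from any such string, then `L_f = {⟨x, bin i⟩ | pad(f x)_i = 1}` (`pad s = s.flatMap (b ↦ [1, b])`) is in `BQP` —
classical wrap of the family by `x ← ⟨x, i⟩` and the post-processor `bitGraph_post_exists`, then
`mem_BQP_of_isQSolvable_bit`. [cite: BennettBernsteinBrassardVazirani1997, Cor. 4.15 (BQP^BQP = BQP)] -/
theorem bitGraph_mem_BQP {f pick : List Bool → List Bool} (hf : IsQSolvable fun x => {y | f x <+: y})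
    (hpick : pick ∈ FP) (hspec : ∀ x y, f x <+: y → pick (boolPair x y) = f x) :
    {u : List Bool | ∃ (x : List Bool) (i : ℕ), u = boolPair x (encodeNat i) ∧
      ((f x).flatMap fun b => [true, b]).getD i false = true} ∈ BQP := by
  obtain ⟨g, hg, hgs⟩ := bitGraph_post_exists hpick
  classical
  have hW := isQSolvable_classicalWrap_holds fstF g fstF_mem_FP hg hf
  have hbit : IsQSolvable fun u => {z | [decide (u ∈ {u : List Bool | ∃ (x : List Bool) (i : ℕ),
      u = boolPair x (encodeNat i) ∧ ((f x).flatMap fun b => [true, b]).getD i false = true})] <+: z} := by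
    refine hW.mono fun u z hz => ?_
    obtain ⟨y, hy, hz⟩ := hz
    rw [hgs u y, hspec _ _ hy] at hz
    have key : (if decide (decodeNat (sndF u) % 2 = 0) then decide (decodeNat (sndF u) / 2 < (f (fstF u)).length)
        else (f (fstF u)).getD (decodeNat (sndF u) / 2) false) =
        ((f (fstF u)).flatMap fun b => [true, b]).getD (decodeNat (sndF u)) false := by
      rw [getD_pad]
      by_cases h : decodeNat (sndF u) % 2 = 0 <;> simp [h]
    rw [key] at hz
    have hb : decide (u ∈ {u : List Bool | ∃ (x : List Bool) (i : ℕ), u = boolPair x (encodeNat i) ∧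
        ((f x).flatMap fun b => [true, b]).getD i false = true}) =
        (decide (u = boolPair (fstF u) (encodeNat (decodeNat (sndF u)))) &&
          ((f (fstF u)).flatMap fun b => [true, b]).getD (decodeNat (sndF u)) false) := by
      rw [Bool.eq_iff_iff, decide_eq_true_iff, Bool.and_eq_true, decide_eq_true_iff]
      constructor
      · rintro ⟨x, i, rfl, hb⟩
        rw [fstF_boolPair, sndF_boolPair, decode_encodeNat]
        exact ⟨rfl, hb⟩
      · rintro ⟨hu, hb⟩
        exact ⟨_, _, hu, hb⟩
    show [_] <+: z
    rw [hb]
    exact hz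
  exact mem_BQP_of_isQSolvable_bit (fun _ _ => QCircuit.outputPMF_apply_holds) cliffordT_isUnitary_holds
    (fun u => decide_eq_true_iff) hbit

/-! ### Evaluating an `FBQP` function through its bit-graph oracle -/

/-- Pieces `[b]` / `[]` flatten to a `filterMap`. [folklore] -/
theorem flatten_map_ite {α : Type} (l : List α) (c v : α → Bool) :
    (l.map fun k => if c k then [v k] else []).flatten = l.filterMap fun k => if c k then some (v k) else none := by
  induction l with
  | nil => rfl
  | cons a l ih =>
    rw [List.map_cons, List.flatten_cons, ih, List.filterMap_cons]
    by_cases h : c a <;> simp [h]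

/-- **The un-padding program** (`FP`): `⟨x, a⟩ ↦ ⟨x, s⟩` where `s` collects `a_{2k+1}` for the `k < |a|/2` with
`a_{2k} = 1`. [cite: AroraBarak2009, §1.3] -/
theorem unpad_exists : ∃ post : List Bool → List Bool, post ∈ FP ∧ ∀ x a : List Bool, post (boolPair x a) =
    boolPair x ((List.range (a.length / 2)).filterMap fun k =>
      if a.getD (2 * k) false then some (a.getD (2 * k + 1) false) else none) := by
  have cA : CodeFP (pairE strE strE) strE Prod.snd := snd _ _
  have cP : CodeFP (pairE strE strE) unE (fun p => min (p.2.length / 2) p.2.length) :=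
    unOfNatMin.comp ((strLength.comp cA).pair (natDiv.comp ((strNatLength.comp cA).pair (const _ 2))))
  have cPiece : CodeFP (pairE (pairE strE strE) natE) (rawE bitE)
      (fun t => if t.1.2.getD (2 * t.2) false then [t.1.2.getD (2 * t.2 + 1) false] else []) :=
    (strGetDNat.comp ((cA.comp (fst _ _)).pair (natMul.comp ((const _ 2).pair (snd _ _))))).ite
      ((rawSingleton bitE).comp (strGetDNat.comp ((cA.comp (fst _ _)).pair
        (natAdd.comp ((natMul.comp ((const _ 2).pair (snd _ _))).pair (const _ 1))))))
      (const _ [])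
  have cS : CodeFP (pairE strE strE) strE (fun p => ((List.range (min (p.2.length / 2) p.2.length)).map fun k =>
      if p.2.getD (2 * k) false then [p.2.getD (2 * k + 1) false] else []).flatten) :=
    (bitsToStr.comp ((flatten bitE).comp ((CodeFP.map cPiece).comp ((CodeFP.id _).pair (urange.comp cP))))).congr
      fun _ => rfl
  obtain ⟨post, hpost, hps⟩ := ((fst strE strE).pair cS).recodeOut (eγ := strE) (g' := fun p => boolPair p.1
    ((List.range (p.2.length / 2)).filterMap fun k => if p.2.getD (2 * k) false then some (p.2.getD (2 * k + 1) false)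
      else none)) fun p => by
        simp only [pairE, strE, id, Nat.min_eq_left (Nat.div_le_self _ _), flatten_map_ite]
  exact ⟨post, hpost, fun x a => hps (x, a)⟩

/-- **Evaluating `f` through the oracle `L_f`** (an adaptive `FP` program): ask the `2·p(|x|)` bits of `pad (f x)`
in parallel (`AdPres.batch`) and un-pad (`unpad_exists`), for any polynomial bound `|f x| ≤ p(|x|)`.
[cite: AroraBarak2009, §3.4] -/
theorem adPres_graph {f : List Bool → List Bool} (p : Polynomial ℕ) (hp : ∀ x, (f x).length ≤ p.eval x.length) :
    AdQuery.AdPres {u : List Bool | ∃ (x : List Bool) (i : ℕ), u = boolPair x (encodeNat i) ∧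
      ((f x).flatMap fun b => [true, b]).getD i false = true} (fun x => boolPair x (f x)) := by
  set L : Language Bool := {u : List Bool | ∃ (x : List Bool) (i : ℕ), u = boolPair x (encodeNat i) ∧
      ((f x).flatMap fun b => [true, b]).getD i false = true}
  have hmem : ∀ (x : List Bool) (i : ℕ), L.boolIndicator (boolPair x (encodeNat i)) =
      ((f x).flatMap fun b => [true, b]).getD i false := by
    intro x i
    have hiff : boolPair x (encodeNat i) ∈ L ↔ ((f x).flatMap fun b => [true, b]).getD i false = true := by
      constructor
      · rintro ⟨x', i', h, hb⟩
        obtain ⟨rfl, h2⟩ := Prod.mk.inj (boolPair_injective (show Function.uncurry boolPair (x, encodeNat i) =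
          Function.uncurry boolPair (x', encodeNat i') from h))
        rwa [show i = i' from by simpa using congrArg decodeNat h2]
      · exact fun hb => ⟨x, i, rfl, hb⟩
    by_cases h : boolPair x (encodeNat i) ∈ L
    · rw [(Set.mem_iff_boolIndicator _ _).1 h, eq_comm]; exact hiff.1 h
    · rw [(Set.notMem_iff_boolIndicator _ _).1 h, eq_comm, ← Bool.not_eq_true]; exact fun hb => h (hiff.2 hb)
  have hid : (fun w : List Bool => w) ∈ FP := PolyTimeComputable.id _
  have hb := AdQuery.AdPres.batch (A := L) hid (2 * p)
  obtain ⟨post, hpost, hps⟩ := unpad_exists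
  have h := hb.FP_comp hpost
  refine (show (fun x => boolPair x (f x)) = post ∘ _ from funext fun x => ?_) ▸ h
  rw [Function.comp_apply, hps, List.length_map, List.length_range, Polynomial.eval_mul, Polynomial.eval_ofNat,
    Nat.mul_div_cancel_left _ two_pos]
  simp only [hmem]
  rw [unpad_eq (f x) (hp x)]

/-! ### The prime factorisation as an oracle -/

/-- The prime factorisation code has polynomial length: `|encode (primeFactorsList m)| ≤ 2(|x| + 2)²` for
`m = decodeNat x` (at most `|x|+1` factors, each `< 2^{|x|+1}`). [folklore] -/
theorem length_encode_primeFactorsList_le (x : List Bool) :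
    (encodingListNatBool.encode (decodeNat x).primeFactorsList).length ≤
      (2 * (Polynomial.X + 2) ^ 2 : Polynomial ℕ).eval x.length := by
  set m := decodeNat x with hm
  set l := m.primeFactorsList with hl
  have hmlt : m < 2 ^ (x.length + 1) := decodeNat_lt_two_pow_succ x
  have hlen : l.length ≤ x.length + 1 := by
    have h2 : ∀ l' : List ℕ, (∀ q ∈ l', q.Prime) → 2 ^ l'.length ≤ l'.prod := by
      intro l' hl'
      induction l' with
      | nil => simp
      | cons a l' ih =>
        rw [List.length_cons, pow_succ', List.prod_cons]
        exact Nat.mul_le_mul (hl' a List.mem_cons_self).two_le (ih fun q hq => hl' q (List.mem_cons_of_mem _ hq))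
    rcases Nat.eq_zero_or_pos m with h0 | h0
    · rw [hl, h0, Nat.primeFactorsList_zero]; simp
    · have := (h2 l fun q hq => Nat.prime_of_mem_primeFactorsList hq).trans_lt
        ((Nat.prod_primeFactorsList h0.ne').symm ▸ hmlt)
      exact ((pow_lt_pow_iff_right₀ (by norm_num : (1 : ℕ) < 2)).1 this).le
  have hitem : ∀ q ∈ l, (natE q).length ≤ x.length + 1 := fun q hq =>
    (length_natE_mono (Nat.le_of_mem_primeFactorsList hq)).trans (length_natE_le_of_lt hmlt)
  rw [show (encodingListNatBool.encode : List ℕ → List Bool) = listE natE from listE_eq encodingNatBool]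
  simp only [listE, length_boolPair, length_unE, length_rawE, Polynomial.eval_mul, Polynomial.eval_pow,
    Polynomial.eval_add, Polynomial.eval_X, Polynomial.eval_ofNat]
  have hsum : (l.map fun a => 2 * (natE a).length + 2).sum ≤ l.length * (2 * (x.length + 1) + 2) := by
    refine (List.sum_le_card_nsmul _ _ fun v hv => ?_).trans (by rw [List.length_map, smul_eq_mul])
    obtain ⟨q, hq, rfl⟩ := List.mem_map.1 hv
    have := hitem q hq; omega
  have h1 : l.length * (2 * (x.length + 1) + 2) ≤ (x.length + 1) * (2 * (x.length + 1) + 2) := Nat.mul_le_mul_right _ hlen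
  nlinarith

/-- **The bit-graph language of the prime factorisation is in `BQP`** (Shor's PROVED `isQSolvable_factoring_holds`;
the canonicaliser re-encodes the decoded prefix, the list code being self-delimiting). [cite: Shor1997SICOMP, §5] -/
theorem factorGraph_mem_BQP :
    {u : List Bool | ∃ (x : List Bool) (i : ℕ), u = boolPair x (encodeNat i) ∧
      ((encodingListNatBool.encode (decodeNat x).primeFactorsList).flatMap fun b => [true, b]).getD i false = true} ∈
      BQP := by
  refine bitGraph_mem_BQP (pick := canonLFn ∘ sndF) isQSolvable_factoring_holds
    (comp_mem_FP canonLFn_mem_FP sndF_mem_FP) fun x y hy => ?_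
  obtain ⟨t, rfl⟩ := hy
  rw [Function.comp_apply, sndF_boolPair, canonLFn_eq]
  congr 1
  have h1 := Literature.Computability.Complexity.Knapsack.decode_natList
    (encodingListNatBool.encode (decodeNat x).primeFactorsList ++ t)
  rw [listBool_decode_encode_append] at h1
  exact (Option.some.inj h1).symm

/-- **The prime factorisation through its oracle**: `x ↦ ⟨x, encode (primeFactorsList (decodeNat x))⟩` is an
adaptive `FP` program over the bit-graph language of the factorisation (hence in `FP` relative to it, and usable as
a stage of any `FP^{… ⊕ FACTORBITS ⊕ …}` machine). [cite: AroraBarak2009, §3.4] -/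
theorem adPres_primeFactors :
    AdQuery.AdPres {u : List Bool | ∃ (x : List Bool) (i : ℕ), u = boolPair x (encodeNat i) ∧
      ((encodingListNatBool.encode (decodeNat x).primeFactorsList).flatMap fun b => [true, b]).getD i false = true}
      (fun x => boolPair x (encodingListNatBool.encode (decodeNat x).primeFactorsList)) :=
  adPres_graph (f := fun x => encodingListNatBool.encode (decodeNat x).primeFactorsList) _
    length_encode_primeFactorsList_le

end Literature.Computability.QuantumComplexity
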